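import Mathlib

/-!
# NegationLens6g8 — the arithmetic skeleton of the δ-descent under the centre rule of record (lens-6, gen 8)

Crux workfile for `stmt-ResolutionOfSingularities-0549` (`Theses.Descent.DescentPerfectToAll`), companion to the memo
`Cruxes/DescentPerfectToAll/NEGATION-lens6-g8.md`.  Mathlib-only; it certifies ARITHMETIC, not geometry:

* `natDegree_derivative_X_mul_le` (K1): the characteristic-`p` degree drop that bounds the number of births on the
  successor curve of a tower — if `p ∣ m` and `deg g ≤ m - 1` then `deg (X·g)' ≤ m - 2` over `ZMod p`
  (memo §3.1: `λ_new(v) = v·g(v)/2`, births = roots of `D_p λ_new`, so `r*(c') ≤ 1 + (m - 2) = δ_L(c) - 1`).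
* `chain_bound` (K2): if along a chain of births the leaf contacts `d 0, d 1, …` strictly decrease and every breeding
  generation `i < n` has `p ∣ d i` and `0 < d i`, then `n * p ≤ d 0` — at most `δ_L(c)/p` breeding generations
  (memo §3.3; attained by the engineered chains `2p → p → stop`).

[OURS · CANDIDATE] counted 0; nothing here proves resolution in char p; resolution in char p NOT proved;
rung B lives in dim ≥ 4.  No `sorry`, no new axioms.
-/

set_option linter.dupNamespace false

namespace Summit.ResolutionOfSingularities.ResolutionOfSingularities.Cruxes.DescentPerfectToAll.NegationLens6g8

open Polynomial

/-- (K1) Degree drop in characteristic `p`: for `p ∣ m`, `0 < m` and `g` of degree `≤ m - 1` over `ZMod p`,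
the derivative of `X * g` has degree `≤ m - 2` (the `X^(m-1)`-coefficient of the derivative is `m • g_(m-1) = 0`). -/
theorem natDegree_derivative_X_mul_le (p : ℕ) [Fact p.Prime] (m : ℕ) (hm : p ∣ m) (hm0 : 0 < m)
    (g : (ZMod p)[X]) (hg : g.natDegree ≤ m - 1) :
    (derivative (X * g)).natDegree ≤ m - 2 := by
  rw [natDegree_le_iff_coeff_eq_zero]
  intro N hN
  rw [coeff_derivative, coeff_X_mul]
  by_cases hNm : m ≤ N
  · have : g.coeff N = 0 := coeff_eq_zero_of_natDegree_lt (by omega)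
    rw [this, zero_mul]
  · have hN1 : N + 1 = m := by omega
    have hcast : ((N : ZMod p) + 1) = 0 := by
      have h2 : ((N + 1 : ℕ) : ZMod p) = 0 := by
        rw [hN1]; exact (ZMod.natCast_eq_zero_iff m p).mpr hm
      push_cast at h2
      exact h2
    rw [hcast, mul_zero]

/-- (K2) Chain bound: strictly decreasing contacts whose breeding generations are positive multiples of `p`
allow at most `d 0 / p` breeding generations. -/
theorem chain_bound (p : ℕ) :
    ∀ (n : ℕ) (d : ℕ → ℕ), (∀ i < n, p ∣ d i ∧ 0 < d i ∧ d (i + 1) < d i) → n * p ≤ d 0 := by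
  intro n
  induction n with
  | zero => intro d _; simp
  | succ k ih =>
    intro d h
    obtain ⟨hp0, hpos0, hlt0⟩ := h 0 (by omega)
    have hlt0' : d 1 < d 0 := by simpa using hlt0
    have hk : k * p ≤ d 1 := ih (fun i => d (i + 1)) (fun i hi => h (i + 1) (by omega))
    rcases Nat.eq_zero_or_pos k with hk0 | hkpos
    · subst hk0
      have : p ≤ d 0 := Nat.le_of_dvd hpos0 hp0
      simpa using this
    · obtain ⟨hp1, -, -⟩ := h 1 (by omega)
      obtain ⟨a, ha⟩ := hp0
      obtain ⟨b, hb⟩ := hp1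
      have hba : b + 1 ≤ a := by
        by_contra hcon
        have hab : a ≤ b := by omega
        have := Nat.mul_le_mul_left p hab
        omega
      have hmul : p * (b + 1) ≤ p * a := Nat.mul_le_mul_left p hba
      have hring : p * (b + 1) = p * b + p := by ring
      have hring2 : (k + 1) * p = k * p + p := by ring
      omega

/-- (K2′) The form used in the memo: a chain starting at contact `k * p` has at most `k` breeding generations
(for `0 < p`). -/
theorem breeding_generations_le (p k n : ℕ) (hp : 0 < p) (d : ℕ → ℕ) (hd0 : d 0 = k * p)
    (h : ∀ i < n, p ∣ d i ∧ 0 < d i ∧ d (i + 1) < d i) : n ≤ k := by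
  have := chain_bound p n d h
  rw [hd0] at this
  exact Nat.le_of_mul_le_mul_right this hp

end Summit.ResolutionOfSingularities.ResolutionOfSingularities.Cruxes.DescentPerfectToAll.NegationLens6g8
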